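import Literature.AnabelianGeometry.EtaleTheta.Discharge.Sec2Cor218ivTrivialBaseDY
import Literature.AnabelianGeometry.EtaleTheta.ThetaRigidityToyLevelThree
import HarnessLib

/-!
# [EtTh] Cor. 2.18 (iv), fibres, at the DISCRETE HEISENBERG SKELETON of `(Π^tp_X)^Θ`: an abelian-`Π^tp_Y`
# toy with `μ_3 ≠ 1` where the clause HOLDS — by the clause `D_Y ↦ D_Y` (proof-only)

S. Mochizuki, *The Étale Theta Function …* [EtTh], Publ. RIMS **45** (2009), §1 p. 35 (the theta quotient
`1 → Δ_Θ → Δ^Θ_X → Δ^ell_X → 1`, `[·,·] : Δ^ell_X × Δ^ell_X → Δ_Θ`), §2 Def. 2.13 (i)–(ii) p. 47, Prop. 2.14 (i)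
p. 49, Cor. 2.18 (iv) pp. 61–63 (locators `p.N` = PDF pages; bib key `MochizukiEtTh2009`).

PROOF-ONLY (no `def`, no instance, no new named fact; cell `abc-iut`, seat abc-iut-f-151, tranche 151,
row F-0638 `ThetaEnvData.Cor218_iv_fibre`).  At abc-iut-w5-d175's level-`3` toy (`Π^tp_X = ℤ × ℤ/2 × ℤ/3`
abelian, `D_Y = 1`) the fibre clause FAILS: the coefficient inversion extends over the abelian `Π^tp_Y`
(`RigidData.ToyN3.not_forall_cor218_iv_fibre`).  Print's rigidity does not come from a non-abelian
`Π^tp_Y` but from the `Gal(Y/X) ≅ l·ℤ`-part of `D_Y` (Prop. 2.14 (i): "`γ(β)·β⁻¹`" sweeps out `l·Δ_Θ`).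
This file exhibits that mechanism in the kernel at the smallest faithful toy:

**`exists_cor218_iv_fibre_of_DY`** — `Π^tp_X := ℤ² ⋊ ℤ`, the discrete Heisenberg group
`⟨a, b, c | [a, b] = c central⟩` (`a` = the deck transformation of the `ℤ`-covering `Y → X`, `c` = the
generator of `Δ_Θ`), `Π^tp_Y := ⟨b, c⟩ ≅ ℤ²` (ABELIAN), `Π^tp_Ÿ := ⟨b², c⟩`, `G_K := 1`, `μ_3 := ℤ/3`, theta
cocycle `η₀ : bᵝ cᵞ ↦ γ mod 3` (so `η₀` DOES extend to `Π^tp_Y`); then `|μ| = 3`, `Π^tp_Y` is commutative,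
`D_Y ≠ 1`, and `Cor218_iv_fibre` HOLDS: by `cor218_iv_fibre_of_coeff_rigid_conj`, the homomorphism part
`f` of an automorphism over `id_{Π^tp_Y}` is invariant under conjugation by `a` (clause `D_Y ↦ D_Y`), so
`f(c) = f(a b a⁻¹ · b⁻¹) = 1`, whence `ψ` fixes `η₀(c) = ζ` and `ψ = id`.

HONEST FRAMING: a statement about the cell's own typing at one explicit toy; nothing here bears on [EtTh]
(refereed) or on [IUTchIII] Cor. 3.12; no side taken; typed ≠ proved.
-/

namespace Literature.AnabelianGeometry.EtaleTheta

namespace ThetaEnvData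

open RigidData.ToyN3 (M3)

/-- In `μ_3 = ℤ/3`, an automorphism fixing the generator `ζ = 1 mod 3` is the identity.
[cite: MochizukiEtTh2009, Def 2.13 p.46] -/
theorem M3.mulEquiv_eq_refl_of_apply_zeta (ψ : M3 ≃* M3)
    (h : ψ (Multiplicative.ofAdd (1 : ZMod 3)) = Multiplicative.ofAdd (1 : ZMod 3)) :
    ψ = MulEquiv.refl M3 := by
  have key : ∀ a : M3, a = 1 ∨ a = Multiplicative.ofAdd (1 : ZMod 3) ∨
      a = Multiplicative.ofAdd (1 : ZMod 3) * Multiplicative.ofAdd (1 : ZMod 3) := by decide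
  refine MulEquiv.ext fun a => ?_
  rcases key a with rfl | rfl | rfl
  · rw [map_one]; rfl
  · exact h
  · rw [map_mul, h]; rfl

/-- **F-0638 at the Heisenberg skeleton: the fibre clause HOLDS with abelian `Π^tp_Y`, `μ_3 ≠ 1`,
`D_Y ≠ 1`.**  There is a `ThetaEnvData` at level `3` — `Π^tp_X := ℤ² ⋊ ℤ` (discrete Heisenberg group,
`a · (β, γ) · a⁻¹ = (β, γ + β)`), `G_K := 1`, `Π^tp_Y := ℤ² = ⟨b, c⟩`, `Π^tp_Ÿ := ⟨b², c⟩`, `μ_3 := ℤ/3`,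
`η₀ : (β, γ) ↦ γ mod 3` — with `|μ| = 3`, `Π^tp_Y` commutative, `D_Y ≠ 1`, at which `Cor218_iv_fibre`
holds (rigidity by the clause `D_Y ↦ D_Y`: `f(c) = 1` since `c = [a, b]`, hence `ψ(ζ) = ζ`).
[cite: MochizukiEtTh2009, Cor 2.18(iv) p.61] -/
theorem exists_cor218_iv_fibre_of_DY :
    ∃ T : ThetaEnvData.{0} 3, Fintype.card T.mu = 3 ∧ (∀ x y : T.PiY, x * y = y * x) ∧ T.DY ≠ ⊥ ∧
      Literature.AnabelianGeometry.EtaleTheta.ThetaEnvData.Cor218_iv_fibre T := by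
  classical
  -- the lattice `ℤ² = ⟨b, c⟩` (written multiplicatively) and the unipotent `u : (β, γ) ↦ (β, γ + β)`
  let V : Type := Multiplicative (ℤ × ℤ)
  let uA : ℤ × ℤ ≃+ ℤ × ℤ :=
    { toFun := fun v => (v.1, v.2 + v.1)
      invFun := fun v => (v.1, v.2 - v.1)
      left_inv := fun v => by ext <;> simp
      right_inv := fun v => by ext <;> simp
      map_add' := fun v w => by ext <;> simp only [Prod.fst_add, Prod.snd_add]; ring }
  let u : V ≃* V := AddEquiv.toMultiplicative uA
  let φ : Multiplicative ℤ →* MulAut V := zpowersHom (MulAut V) u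
  -- `u`, hence every `φ g`, preserves the `b`-coordinate
  let S : Subgroup (MulAut V) :=
    { carrier := {e | ∀ v, (Multiplicative.toAdd (e v)).1 = (Multiplicative.toAdd v).1}
      mul_mem' := fun {e e'} he he' v => by
        change (Multiplicative.toAdd (e (e' v))).1 = _
        rw [he, he']
      one_mem' := fun v => rfl
      inv_mem' := fun {e} he v => by
        have h := he (e⁻¹ v)
        rw [MulAut.apply_inv_self] at h
        exact h.symm }
  have huS : u ∈ S := fun v => rfl
  have hφ1 : ∀ (g : Multiplicative ℤ) (v : V),
      (Multiplicative.toAdd (φ g v)).1 = (Multiplicative.toAdd v).1 := fun g => by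
    have : φ g ∈ S := by
      change u ^ (Multiplicative.toAdd g) ∈ S
      exact S.zpow_mem huS _
    exact this
  -- the Heisenberg group `Π := ℤ² ⋊ ℤ`, discrete
  let P : Type := V ⋊[φ] Multiplicative ℤ
  letI : TopologicalSpace P := ⊥
  haveI : DiscreteTopology P := ⟨rfl⟩
  let PiY : Subgroup P := (SemidirectProduct.rightHom : P →* Multiplicative ℤ).ker
  have mem_PiY : ∀ x : P, x ∈ PiY ↔ x.right = 1 := fun x => Iff.rfl
  -- `β mod 2`, a homomorphism on all of `Π` (the `b`-coordinate is additive on `Π`)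
  let L : P →* Multiplicative (ZMod 2) :=
    { toFun := fun x => Multiplicative.ofAdd (((Multiplicative.toAdd x.left).1 : ℤ) : ZMod 2)
      map_one' := by simp
      map_mul' := fun x y => by
        rw [SemidirectProduct.mul_left, toAdd_mul, Prod.fst_add, hφ1, Int.cast_add, ofAdd_add] }
  let PiYdd : Subgroup P := L.ker ⊓ PiY
  -- named elements: `b = (1,0)`, `c = (0,1)` in `Π_Y`, `a` the generator of the quotient `ℤ`
  let b₀ : V := Multiplicative.ofAdd ((1 : ℤ), (0 : ℤ))
  let c₀ : V := Multiplicative.ofAdd ((0 : ℤ), (1 : ℤ))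
  let a : P := SemidirectProduct.inr (Multiplicative.ofAdd (1 : ℤ))
  have hinl_mem : ∀ v : V, (SemidirectProduct.inl v : P) ∈ PiY := fun v => by
    rw [mem_PiY, SemidirectProduct.right_inl]
  have hc_dd : (SemidirectProduct.inl c₀ : P) ∈ PiYdd := by
    refine ⟨?_, hinl_mem c₀⟩
    change L (SemidirectProduct.inl c₀) = 1
    simp [L, c₀]
  -- `a b a⁻¹ = b c`
  have hφa : φ (Multiplicative.ofAdd (1 : ℤ)) = u := by
    change u ^ Multiplicative.toAdd (Multiplicative.ofAdd (1 : ℤ)) = u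
    rw [toAdd_ofAdd, zpow_one]
  have hub : u b₀ = b₀ * c₀ := rfl
  have haba : a * SemidirectProduct.inl b₀ * a⁻¹ =
      (SemidirectProduct.inl b₀ * SemidirectProduct.inl c₀ : P) := by
    rw [← map_inv, ← SemidirectProduct.inl_aut, hφa, hub, map_mul]
  -- multiplication inside `Π_Y` is coordinatewise (the action enters through `right = 1`)
  have hmul_left : ∀ x y : P, x ∈ PiY → (x * y).left = x.left * y.left := fun x y hx => by
    rw [SemidirectProduct.mul_left, (mem_PiY x).mp hx, map_one, MulAut.one_apply]
  have index_PiYdd : (PiYdd.subgroupOf PiY).index = 2 := by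
    change PiYdd.relIndex PiY = 2
    rw [Subgroup.inf_relIndex_right, Subgroup.relIndex_ker]
    have hmap : PiY.map L = ⊤ := by
      have key : ∀ t : Multiplicative (ZMod 2), t = 1 ∨ t = Multiplicative.ofAdd 1 := by decide
      refine top_le_iff.mp fun t _ => ?_
      rcases key t with rfl | rfl
      · exact ⟨1, PiY.one_mem, map_one L⟩
      · exact ⟨SemidirectProduct.inl b₀, hinl_mem b₀, by simp [L, b₀]⟩
    rw [hmap, Subgroup.card_top, Nat.card_eq_fintype_card]
    rfl
  haveI hPiYdd_normal : PiYdd.Normal := inferInstance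
  -- the theta cocycle `η₀ : γ mod 3`
  let q : P → M3 := fun x => Multiplicative.ofAdd (((Multiplicative.toAdd x.left).2 : ℤ) : ZMod 3)
  have q_mul : ∀ x y : P, x ∈ PiY → q (x * y) = q x * q y := fun x y hx => by
    change Multiplicative.ofAdd ((((Multiplicative.toAdd (x * y).left).2 : ℤ) : ZMod 3)) = _
    rw [hmul_left x y hx, toAdd_mul, Prod.snd_add, Int.cast_add, ofAdd_add]
  let η₀ : PiYdd → M3 := fun y => q y
  -- the data
  let T : ThetaEnvData.{0} 3 :=
    { PiX := P
      G := PUnit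
      aug := 1
      aug_surjective := fun _ => ⟨1, Subsingleton.elim _ _⟩
      PiY := PiY
      PiY_normal := MonoidHom.normal_ker _
      PiY_open := isOpen_discrete _
      galYX := QuotientGroup.quotientKerEquivOfSurjective _ SemidirectProduct.rightHom_surjective
      PiYdd := PiYdd
      PiYdd_le := inf_le_right
      PiYdd_normal := hPiYdd_normal
      PiYdd_open := isOpen_discrete _
      index_PiYdd := index_PiYdd
      mu := M3
      mu_cyclic := inferInstance
      card_mu := rfl
      chi := 1
      chi_ker_open := isOpen_discrete _
      thetaCocycles := {η₀}
      thetaCocycles_nonempty := Set.singleton_nonempty _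
      isCocycle := by
        rintro η hη
        rw [Set.mem_singleton_iff] at hη
        subst hη
        intro x y
        change q ((x : P) * y) = q x * q y
        exact q_mul x y x.2.2
      locallyConstant := fun η _ => IsLocallyConstant.of_discrete η
      mul_coboundary_mem := by
        rintro η hη c
        rw [Set.mem_singleton_iff] at hη ⊢
        subst hη
        funext x
        simp [CycEnvelope.coboundary] }
  haveI hG : Subsingleton T.G := inferInstanceAs (Subsingleton PUnit)
  have hY_comm : ∀ x y : T.PiY, x * y = y * x := by
    rintro ⟨x, hx⟩ ⟨y, hy⟩
    apply Subtype.ext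
    change x * y = y * x
    refine SemidirectProduct.ext ?_ ?_
    · rw [hmul_left x y hx, hmul_left y x hy, mul_comm]
    · rw [SemidirectProduct.mul_right, SemidirectProduct.mul_right, (mem_PiY x).mp hx,
        (mem_PiY y).mp hy]
  refine ⟨T, rfl, hY_comm, fun hD => ?_, ?_⟩
  · -- `D_Y ≠ 1`: `[conj_a]` is not inner, since the envelope `μ_3 × Π_Y` is abelian and `a b a⁻¹ ≠ b`
    have hmem := T.mk_conjX_mem_DY a
    rw [hD, Subgroup.mem_bot] at hmem
    have hmem' : (⟨T.conjX a, T.conjX_mem_contMulAut a⟩ : contMulAut T.env) ∈ innerContAut T.env :=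
      (QuotientGroup.eq_one_iff _).mp hmem
    obtain ⟨e, he⟩ := (Subgroup.mem_subgroupOf.mp hmem' : _)
    have henv_comm : ∀ x y : T.env, x * y = y * x := fun x y =>
      SemidirectProduct.ext (by rw [T.mul_left_eq, T.mul_left_eq, mul_comm]) (by
        rw [SemidirectProduct.mul_right, SemidirectProduct.mul_right, hY_comm])
    have he' : MulAut.conj e = T.conjX a := he
    have hconj1 : T.conjX a = 1 := by
      rw [← he']
      refine MulEquiv.ext fun x => ?_
      rw [MulAut.conj_apply, henv_comm e x, mul_inv_cancel_right]
      rfl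
    have h1 := congrArg (fun F : MulAut T.env =>
      (((F (CycEnvelope.algSection T.augY T.chi ⟨SemidirectProduct.inl b₀, hinl_mem b₀⟩)).right
        : T.PiY) : P)) hconj1
    change a * SemidirectProduct.inl b₀ * a⁻¹ = SemidirectProduct.inl b₀ at h1
    rw [haba, ← map_mul] at h1
    have h2 : b₀ * c₀ = b₀ * 1 := (SemidirectProduct.inl_injective h1).trans (mul_one b₀).symm
    have h3 : c₀ = 1 := mul_left_cancel h2
    have h4 := congrArg (fun v : V => (Multiplicative.toAdd v).2) h3
    simp [c₀] at h4
  · -- the fibre clause, by the `D_Y`-aware rigidity criterion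
    refine T.cor218_iv_fibre_of_coeff_rigid_conj fun η hη ψ f hf hfinv => ?_
    have h1 : η = η₀ := hη
    subst h1
    -- invariance under `a`: `f(b c) = f(a b a⁻¹) = f(b)`, so `f(c) = 1`
    let yb : T.PiY := ⟨SemidirectProduct.inl b₀, hinl_mem b₀⟩
    let yc : T.PiY := ⟨SemidirectProduct.inl c₀, hinl_mem c₀⟩
    have hconj : (⟨a * (yb : T.PiX) * a⁻¹, T.PiY_normal.conj_mem _ yb.2 a⟩ : T.PiY) = yb * yc :=
      Subtype.ext haba
    have hfc : f yc = 1 := by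
      have h := hfinv a yb
      rw [hconj, map_mul] at h
      exact mul_eq_left.mp h
    -- on `Π_Ÿ ∋ c`: `f(c) = ψ(ζ) · ζ⁻¹`, and `η₀(c) = ζ`
    have hζ : ψ (Multiplicative.ofAdd (1 : ZMod 3) : M3) = (Multiplicative.ofAdd (1 : ZMod 3) : M3) := by
      have h := hf ⟨SemidirectProduct.inl c₀, hc_dd⟩
      have hq : η₀ ⟨SemidirectProduct.inl c₀, hc_dd⟩ = (Multiplicative.ofAdd (1 : ZMod 3) : M3) := by
        change q (SemidirectProduct.inl c₀) = _
        simp [q, c₀]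
      rw [hq] at h
      have hyc : T.inclYdd ⟨SemidirectProduct.inl c₀, hc_dd⟩ = yc := rfl
      rw [hyc, hfc] at h
      exact ((eq_mul_inv_iff_mul_eq.mp h).symm.trans (one_mul _))
    exact M3.mulEquiv_eq_refl_of_apply_zeta ψ hζ

end ThetaEnvData

end Literature.AnabelianGeometry.EtaleTheta
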